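import Summits.BirchSwinnertonDyer.BirchSwinnertonDyer.Theorems.UniversalToricDescentHessianTwinAtThree
import Literature.NumberTheory.EllipticCurves.FormalLeafDenominatorsProofs
import Literature.NumberTheory.EllipticCurves.PAdicGrossZagierConstantTermProofs
import HarnessLib

/-!
# Route `UniversalToricDescent`, crux #3 bucket C (item stmt-BirchSwinnertonDyer-20695): THE SUPPLY OF AN `a₃ = 0` TWIN IS A THEOREM — every curve with a good-supersingular `3`-congruent twin has one with `a₃ = 0` (PROVED, unconditional, no type hypothesis)

Cell `bsd-wall` (W-ALL lane 3, row 2·3@3), seat `bsd-wall-utd-p2` g7 (LEAD, line mode on item 20695), 2026-08-28.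
`--supports stmt-BirchSwinnertonDyer-20695`. Sequel of `UniversalToricDescentHessianTwinAtThree.lean` (p583681: on the
`3`-adic type `c₄ = 3⁴u`, `3 ∤ u`, `c₆ = 3⁷w` the Hessian member `D(0:1)` is a `3`-congruent good-supersingular `a₃ = 0` twin).

THE POINT. The supply statement of the twin-choice kernel (seat g6, `UniversalToricDescentTwinChoiceKernelAtThree.lean`
p576995 §3 / `…ByName` §4: `∀ W, HasGoodSSTwinAtThree W → HasGoodSSApZeroTwinAtThree W`; memo SUPSET-AT3-v9 §2:
"folklore-provable … not kernel-provable today") is PROVED here for EVERY elliptic `W/ℚ`, by applying the Hessian TWICE: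
* §1 a globally minimal `W′` with GOOD SUPERSINGULAR reduction at `3` has `3 ∣ b₂`, hence `c₄(W′) = 3u` with `3 ∤ u` and
  `c₆(W′) = 27w` (`u, w ∈ ℤ`): `a₃ ≡` Hasse invariant `= b₂ (mod 3)` (Silverman V.4.1(a), the tree's
  `intCast_frobeniusTrace_eq_hasseCoeff`), `c₄ = b₂² − 24b₄`, `c₆ = −b₂³ + 36b₂b₄ − 216b₆`, and `3 ∤ u` from `3 ∤ Δ_min`
  (`1728Δ = c₄³ − c₆²`);
* §2 then the Hessian member `D(0:1)` of `W′`, rescaled by `3`, has `c₄ = 3⁴·16(36w² − u³)` (`3 ∤ 16(36w² − u³)`) and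
  `c₆ = 3⁷·192(u³w − 24w³)` — it is a (wild) curve of the type `(4, ≥ 8)` treated by p583681 — so ITS Hessian is a
  `3`-congruent twin with good supersingular reduction and `a₃ = 0` (`hasGoodSSApZeroTwinAtThree_of_c₄_c₆`);
* §3 composing the three `3`-congruences (`W″ ~ He(W′)`, `He(W′) ~ W′` by Fisher Thm. 13.2 — tree-proved — and `W′ ~ W`):
  `hasGoodSSApZeroTwinAtThree_of_goodSS_twin`, and
  **`hasGoodSSApZeroTwinAtThree_of_hasGoodSSTwinAtThree : HasGoodSSTwinAtThree W → HasGoodSSApZeroTwinAtThree W`**.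
CONSEQUENCE (by name, in `…HessianTwinSupplyKernelAtThree.lean`): g6's `wAllExclAddWildRankOneSurjTwin_of_apZero_of_supply` /
`bsdp_three_of_apZero_of_supply` lose their supply hypothesis — the W-ALL twin leaf follows from {published inputs,
transport, printed facts (A) + closed 20693, B crux 20694, the `a₃ = 0` HALF of 20695, Waldspurger, control, rank-zero twist}:
item 20695's `a₃ = ±3` half and the R2′ supply item are NOT load-bearing for ANY curve (not only on the census type).

HONEST FRAMING: helper theorems; the `a₃ = 0` half of crux #3-C (anticyclotomic IMC `⊇`/`=` at a supersingular `3`,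
`a₃ = 0`) stays research; nothing closes; no statement item filed (D-0014); no new definition; BSD is not proved for any
curve. References: J. H. Silverman, *AEC* V.4.1(a), III §1, VII.5 Prop. 5.1 [SilvermanAEC2009]; T. Fisher, Proc. LMS (3)
104 (2012) §8, Thm. 13.2 [Fisher2012Hessian]; J.-P. Serre, Invent. Math. 15 (1972) §1.11 [Serre1972] (why an `a₃ = 0` twin
must exist); memos HOME/bsd-wall-utd-p2/SUPSET-AT3-v9.md §2, v10 §3.
-/

set_option autoImplicit false
set_option linter.dupNamespace false

noncomputable section

namespace Summit.BirchSwinnertonDyer.BirchSwinnertonDyer.Theorems.UniversalToricDescentHessianTwin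

open WeierstrassCurve
  Literature.NumberTheory.EllipticCurves
  Literature.NumberTheory.EllipticCurves.Rank1Residual
  Literature.NumberTheory.EllipticCurves.Fisher2012
  Summit.BirchSwinnertonDyer.Rank1Residual
  Summit.BirchSwinnertonDyer.BirchSwinnertonDyer.Theorems.UniversalToricDescentTwinChoice

/-! ## §1 A good-supersingular curve at `3`: `3 ∣ b₂`, so `c₄ = 3u` (`3 ∤ u`), `c₆ = 27w` -/

/-- **`GoodSS W′ 3 ⟹ 3 ∣ b₂(integralModelInt W′)`**: at a prime of good reduction `a₃ ≡ A₃ (mod 3)`, the Hasse invariant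
`A₃ =` coefficient of `x²` in `Ψ₂²(x)¹ = 4x³ + b₂x² + 2b₄x + b₆`, i.e. `b₂`. [cite: SilvermanAEC2009, V.4.1(a)] -/
theorem three_dvd_b₂_integralModelInt_of_goodSS (W' : WeierstrassCurve ℚ) [W'.IsGloballyMinimal]
    (hss : GoodSS W' 3) : (3 : ℤ) ∣ (integralModelInt W').b₂ := by
  have hΔ : ¬ (3 : ℤ) ∣ (integralModelInt W').Δ :=
    W'.not_dvd_minimalDiscriminantInt_of_hasGoodReductionAtPrime 3 hss.1
  haveI : ((integralModelInt W').map (Int.castRingHom (ZMod 3))).IsElliptic := by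
    rw [WeierstrassCurve.isElliptic_iff, map_Δ, isUnit_iff_ne_zero, eq_intCast, ne_eq,
      ZMod.intCast_zmod_eq_zero_iff_dvd]
    exact_mod_cast hΔ
  have h := W'.intCast_frobeniusTrace_eq_hasseCoeff 3 (by norm_num)
  have hb : ((integralModelInt W').map (Int.castRingHom (ZMod 3))).hasseCoeff 3 =
      ((integralModelInt W').b₂ : ZMod 3) := by
    rw [hasseCoeff, show (3 - 1) / 2 = 1 from rfl, show 3 - 1 = 2 from rfl, pow_one, Cubic.coeff_eq_b]
    simp [WeierstrassCurve.twoTorsionPolynomial, map_b₂]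
  have h0 : ((W'.frobeniusTrace 3 : ℤ) : ZMod 3) = 0 := by
    rw [ZMod.intCast_zmod_eq_zero_iff_dvd]; exact_mod_cast hss.2
  rw [h, hb, ZMod.intCast_zmod_eq_zero_iff_dvd] at h0
  exact_mod_cast h0

/-- `3 ∣ b₂ ⟹ 3 ∣ c₄ ∧ 27 ∣ c₆` for an integer Weierstrass model (`c₄ = b₂² − 24b₄`,
`c₆ = −b₂³ + 36b₂b₄ − 216b₆`). [cite: SilvermanAEC2009, III §1] -/
theorem dvd_c₄_c₆_of_three_dvd_b₂ (E : WeierstrassCurve ℤ) (h : (3 : ℤ) ∣ E.b₂) :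
    (3 : ℤ) ∣ E.c₄ ∧ (27 : ℤ) ∣ E.c₆ := by
  obtain ⟨k, hk⟩ := h
  refine ⟨⟨3 * k ^ 2 - 8 * E.b₄, ?_⟩, ⟨-k ^ 3 + 4 * k * E.b₄ - 8 * E.b₆, ?_⟩⟩
  · rw [WeierstrassCurve.c₄, hk]; ring
  · rw [WeierstrassCurve.c₆, hk]; ring

/-- **The integer invariants of a good-supersingular curve at `3`**: `c₄(W′) = 3u` with `3 ∤ u` and `c₆(W′) = 27w`
(`u, w ∈ ℤ`); `3 ∤ u` because `3 ∣ u` would force `3⁴ ∣ c₄³ − c₆² = 1728Δ = 3³·64Δ`, i.e. `3 ∣ Δ_min`.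
[cite: SilvermanAEC2009, III §1 and VII.5 Prop. 5.1(a)] -/
theorem exists_c₄_c₆_of_goodSS (W' : WeierstrassCurve ℚ) [W'.IsGloballyMinimal] (hss : GoodSS W' 3) :
    ∃ u w : ℤ, ¬ (3 : ℤ) ∣ u ∧ W'.c₄ = 3 * u ∧ W'.c₆ = 27 * w := by
  have hΔ : ¬ (3 : ℤ) ∣ (integralModelInt W').Δ :=
    W'.not_dvd_minimalDiscriminantInt_of_hasGoodReductionAtPrime 3 hss.1
  obtain ⟨⟨u, hu⟩, ⟨w, hw⟩⟩ :=
    dvd_c₄_c₆_of_three_dvd_b₂ _ (three_dvd_b₂_integralModelInt_of_goodSS W' hss)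
  refine ⟨u, w, fun h3 ↦ hΔ ?_, ?_, ?_⟩
  · have hrel := (integralModelInt W').c_relation
    rw [hu, hw] at hrel
    obtain ⟨t, rfl⟩ := h3
    -- `1728 Δ = 27·(27 t³·3 − 27 w²)`: so `3 ∣ 64 Δ`
    have h64 : (3 : ℤ) ∣ 64 * (integralModelInt W').Δ := by
      refine ⟨9 * t ^ 3 - 9 * w ^ 2, ?_⟩
      have h27 : (27 : ℤ) * (64 * (integralModelInt W').Δ) = 27 * (3 * (9 * t ^ 3 - 9 * w ^ 2)) := by
        linear_combination hrel
      exact mul_left_cancel₀ (by norm_num) h27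
    rcases Int.prime_three.dvd_or_dvd h64 with h | h
    · norm_num at h
    · exact h
  · rw [c₄_eq_intCast_c₄_integralModelInt W', hu]; push_cast; ring
  · rw [c₆_eq_intCast_c₆_integralModelInt W', hw]; push_cast; ring

/-! ## §2 The Hessian of a good-supersingular curve is of the type `(4, ≥ 8)` -/

/-- `c₄(D(0:1)) = 1296·(4c₆² − 3c₄³)` and `c₆(D(0:1)) = 46656·(9c₄³c₆ − 8c₆³)` (short model `y² = x³ − 27𝔠₄x − 54𝔠₆`).
[cite: Fisher2012Hessian, §8 (Hesse polynomials, n = 3)] -/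
theorem c₄_c₆_hessePencil3_zero_one (c₄ c₆ : ℚ) :
    (hessePencil3 c₄ c₆ 0 1).c₄ = 1296 * (4 * c₆ ^ 2 - 3 * c₄ ^ 3) ∧
      (hessePencil3 c₄ c₆ 0 1).c₆ = 46656 * (9 * c₄ ^ 3 * c₆ - 8 * c₆ ^ 3) := by
  rw [hessePencil3_eq]
  simp only [WeierstrassCurve.c₄, WeierstrassCurve.c₆, WeierstrassCurve.b₂, WeierstrassCurve.b₄,
    WeierstrassCurve.b₆]
  constructor <;> ring

/-- **The Hessian of a good-supersingular curve has type `(4, ≥ 8)`**: for `c₄(W′) = 3u`, `c₆(W′) = 27w` the model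
`W₁ = ⟨3, 0, 0, 0⟩ • D(0:1)` has `c₄(W₁) = 3⁴ · 16(36w² − u³)` and `c₆(W₁) = 3⁷ · 192(u³w − 24w³)`. [folklore] -/
theorem c₄_c₆_rescale_hessePencil3_of_goodSS_shape (W' : WeierstrassCurve ℚ) (u w : ℤ) (h4 : W'.c₄ = 3 * u)
    (h6 : W'.c₆ = 27 * w) :
    ((⟨Units.mk0 (3 : ℚ) (by norm_num), 0, 0, 0⟩ : VariableChange ℚ) • hessePencil3 W'.c₄ W'.c₆ 0 1).c₄ =
        3 ^ 4 * ((16 * (36 * w ^ 2 - u ^ 3) : ℤ) : ℚ) ∧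
      ((⟨Units.mk0 (3 : ℚ) (by norm_num), 0, 0, 0⟩ : VariableChange ℚ) • hessePencil3 W'.c₄ W'.c₆ 0 1).c₆ =
        3 ^ 7 * ((192 * (u ^ 3 * w - 24 * w ^ 3) : ℤ) : ℚ) := by
  obtain ⟨hc4, hc6⟩ := c₄_c₆_hessePencil3_zero_one W'.c₄ W'.c₆
  rw [variableChange_c₄, variableChange_c₆, hc4, hc6, h4, h6]
  simp only [Units.val_inv_eq_inv_val, Units.val_mk0]
  push_cast
  constructor <;> ring

/-! ## §3 The supply: a good-supersingular twin yields an `a₃ = 0` twin -/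

/-- Transitivity of mod-`p` congruence (composition of `Γ_ℚ`-equivariant isomorphisms). [folklore] -/
theorem modPCongruent_trans {W₁ W₂ W₃ : WeierstrassCurve ℚ} {p : ℕ} (h₁ : O6.ModPCongruent W₁ W₂ p)
    (h₂ : O6.ModPCongruent W₂ W₃ p) : O6.ModPCongruent W₁ W₃ p := by
  obtain ⟨e₁, he₁⟩ := h₁
  obtain ⟨e₂, he₂⟩ := h₂
  exact ⟨e₁.trans e₂, fun σ P ↦ by simp only [AddEquiv.trans_apply, he₁, he₂]⟩

/-- **A good-supersingular `3`-congruent twin yields an `a₃ = 0` good-supersingular `3`-congruent twin** (for every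
elliptic `W/ℚ`): the Hessian of the Hessian of the given twin. [folklore] -/
theorem hasGoodSSApZeroTwinAtThree_of_goodSS_twin (W W' : WeierstrassCurve ℚ) [W.IsElliptic] [W'.IsElliptic]
    [W'.IsGloballyMinimal] (hc : O6.ModPCongruent W' W 3) (hss : GoodSS W' 3) : HasGoodSSApZeroTwinAtThree W := by
  obtain ⟨u, w, hu, h4, h6⟩ := exists_c₄_c₆_of_goodSS W' hss
  have hc4' : W'.c₄ ≠ 0 := by
    rw [h4]
    refine mul_ne_zero (by norm_num) ?_
    intro h
    have hu0 : u = 0 := by exact_mod_cast h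
    exact hu (hu0 ▸ dvd_zero 3)
  haveI := isElliptic_hessePencil3_zero_one W' hc4'
  set C₃ : VariableChange ℚ := ⟨Units.mk0 (3 : ℚ) (by norm_num), 0, 0, 0⟩ with hC₃
  set W₁ : WeierstrassCurve ℚ := C₃ • hessePencil3 W'.c₄ W'.c₆ 0 1 with hW₁
  obtain ⟨h4₁, h7₁⟩ := c₄_c₆_rescale_hessePencil3_of_goodSS_shape W' u w h4 h6
  have hu₁ : ¬ (3 : ℤ) ∣ 16 * (36 * w ^ 2 - u ^ 3) := by
    intro h
    apply hu
    have h' : (3 : ℤ) ∣ 16 * u ^ 3 := ⟨16 * 12 * w ^ 2 - (16 * (36 * w ^ 2 - u ^ 3)) / 3 * 1, by omega⟩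
    rcases Int.prime_three.dvd_or_dvd h' with h16 | hu3
    · norm_num at h16
    · exact Int.prime_three.dvd_of_dvd_pow hu3
  -- the Hessian of `W₁` is the `a₃ = 0` twin of `W₁`
  obtain ⟨W'', i1, i2, hc'', hss'', h0⟩ :=
    hasGoodSSApZeroTwinAtThree_of_c₄_c₆ W₁ (16 * (36 * w ^ 2 - u ^ 3)) (192 * (u ^ 3 * w - 24 * w ^ 3)) hu₁ h4₁ h7₁
  -- congruences: `W″ ~ W₁ ~ W′ ~ W`
  have hc₁ : O6.ModPCongruent W₁ W' 3 := modPCongruent_smul_hessePencil3_zero_one W' hc4' C₃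
  exact ⟨W'', i1, i2, modPCongruent_trans (modPCongruent_trans hc'' hc₁) hc, hss'', h0⟩

/-- **THE SUPPLY IS A THEOREM.** For every elliptic `W/ℚ`: a good-supersingular `3`-congruent twin yields one with
`a₃ = 0` — `HasGoodSSTwinAtThree W → HasGoodSSApZeroTwinAtThree W` (the supply predicate of the twin-choice kernel,
`UniversalToricDescentTwinChoiceDefs.lean` p578655; memo SUPSET-AT3-v9 §2), unconditionally and with no `3`-adic type
hypothesis. [folklore] -/
theorem hasGoodSSApZeroTwinAtThree_of_hasGoodSSTwinAtThree (W : WeierstrassCurve ℚ) [W.IsElliptic]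
    (h : HasGoodSSTwinAtThree W) : HasGoodSSApZeroTwinAtThree W := by
  obtain ⟨W', i1, i2, hc, hss⟩ := h
  exact hasGoodSSApZeroTwinAtThree_of_goodSS_twin W W' hc hss

/-- The two twin predicates are EQUIVALENT. [folklore] -/
theorem hasGoodSSTwinAtThree_iff_hasGoodSSApZeroTwinAtThree (W : WeierstrassCurve ℚ) [W.IsElliptic] :
    HasGoodSSTwinAtThree W ↔ HasGoodSSApZeroTwinAtThree W :=
  ⟨hasGoodSSApZeroTwinAtThree_of_hasGoodSSTwinAtThree W, HasGoodSSApZeroTwinAtThree.hasGoodSSTwinAtThree⟩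

end Summit.BirchSwinnertonDyer.BirchSwinnertonDyer.Theorems.UniversalToricDescentHessianTwin

end
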